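import Summits.QuantumFields.YangMills.Theorems.BalabanUVNodesN22W1AdmissibleAlong

/-!
# BalabanUVNodes ∕ node N22 = NE9 — THE RELATIVE-DISC CENTRED ROAD OVER THE ADMISSIBLE CLASS OF OLDER TERMS, MODULE R1aᴬ: UNCENTRED HEREDITY WITH A GUARD ON THE OLDER TERMS
# (generic guard `Q`; the record's instance «analytic on U^c_j», [I] p. 263) — the ADMISSIBLE-HISTORY edition of module R1a

Cell `pub-ymgap`, HUMAN RULING D-0062 (Track A), R134 ACCELERATION re-seat `pub-ymgap-dag-n22-c` (strategy s1), generation 8, file R1aᴬ of the ADMISSIBLE-HISTORY EDITION SWEEP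
(lens «transfer» Cards T32∕T33∕T35 + Erratum E9, node00-def-W1 (R-a) ∕ W1-13, this seat's `J10-DESIGN.md` §0).  THEOREMS ONLY; §2 is module R1a's `holoBound_recTerm_ofTerms` text
plus three tokens, §3 the record's instance — both PORTED with attribution from the lens's memo-side `LensTransferSketch22.lean` §2∕§2c (ym-lens-BalabanUVNodes-transfer g22, sha16
58b7be635505913f).  Imports module A0 `…N22W1AdmissibleAlong` (§1b `admissibleBelow_along_of_termwise_family`; through it R1a∕R1b and dag-n18-c's file 23).  `--supports` K3⁷
`SpineGivenEndpointR13SepCoPH` (stmt-QuantumFields-20544) as a helper.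

WHY (lens Card T32).  Every HISTORY-UNIVERSAL binder of modules R1a∕R1b∕R2∕J2∕J9-D ranged over the (1.18)-SIZE ball of BARE older-term families.  The faithful (2.14) datum reads the
older terms at fluctuation-MOVED configurations ([I] (2.10)), so its Lemma-2 letters exist only for older terms that are ALSO ANALYTIC IN THE FIELD on the space tables: [I] §1
p. 263's inductive assumption is BOTH (1.18) AND «E^{(j)}(X, g_{j−1}, U, J) is defined and analytic on the space U^c_j(X, α₀, α₁)».  The size-only binders are therefore
UNINHABITABLE at the datum of record (lens Sketch20 `firstOrder_letter_false_over_sizeClass`).  REPAIR (R-a): guard every `∀ old` by the admissible class (node00-def-W1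
`W1.AdmHist sp E₀ r₁ k′`; dag-n18-c's class).  THIS FILE is the guarded heredity: §2 with a GENERIC guard `Q k′ old` inserted in (S-last-T′) (after the size premise) and in (S-226-T′)
(pointwise along the curve) and ONE new hypothesis `hQ` — «`Q` holds for the generated older terms along every history slot-wise in `D`» (node00-def-W1 W1-13's
`W1.RecAdmissibleFamBelow (GenTower.ofTerms L TF) D Q Kr` unfolded) — SAME conclusion, SAME induction, SAME invariant as R1a (at `Q := ⊤` it IS R1a); §3 the record's instance
`Q := «analytic on the tables»`, whose `hQ` is SUPPLIED by module A0 §1b (dag-n18-c's heredity BY NAME on the frozen family) from ONE new displayed termwise schema (T-an)[TF] —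
φ-analyticity of every term at admissible older terms, slot-wise on `D` ([II] (2.14) p. 15 «analytic function of (U, J)» with Lemma 2) — plus the tables' restriction property and
N18's strict [KP86] clause; its (T-226) input is the guarded (S-last-T′) itself.

HONEST FRAMING.  Count-neutral by-name knit AT THE OBJECT; NOT a discharge of N22.  (S-last-T′)ᴬ, (S-226-T′)ᴬ, (T-an) are DISPLAYED hypotheses on the term functional of record and
asserted nowhere; NE9 NOT IN PRINT for d = 4; one finite four-torus programme at fixed ε — NOT infinite volume, NOT OS on ℝ⁴, NOT a mass gap, NOT Clay.  0 `sorry`, 0 `def`, standard axioms.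

References (TYPES only): [I] = [Balaban1987RG1] §0 p. 256, Thm 1 p. 259, §1 p. 263 ((1.18) and the clause before it), p. 266, (2.13) p. 268; [II] = [Balaban1988RG2Cluster] (1.41) p. 11,
(2.9)–(2.14) pp. 14–15, (2.26) p. 17, Lemma 3 (2.38) p. 20, (2.39)–(2.41) p. 21, p. 22.
-/

noncomputable section

namespace YMDAG.N22.W1

open Set Metric
open scoped BigOperators
open Literature.MathematicalPhysics.QuantumFieldTheory.Balaban1983to89
open Literature.MathematicalPhysics.QuantumFieldTheory.Balaban1983to89.T4Continuum (T4Family)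
open Literature.MathematicalPhysics.QuantumFieldTheory.Balaban1983to89.T4OutputRate
open Literature.MathematicalPhysics.QuantumFieldTheory.Balaban1983to89.TreeLengthTorus (TPt TDom tsys torusTreeLen torusTreeLen_nonneg)
open Literature.MathematicalPhysics.QuantumFieldTheory.Balaban1983to89.B12TreeDecay (K₀ K₀_pos)
open Literature.MathematicalPhysics.QuantumFieldTheory.Balaban1983to89.B13Lemma3TorusData (TBond)
open Literature.MathematicalPhysics.QuantumFieldTheory.Balaban1983to89.B13Lemma3TorusTerms (terms weight weight_nonneg)
open Literature.MathematicalPhysics.QuantumFieldTheory.Balaban1983to89.B13Lemma3TorusSocket (Lemma3Numerics)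
open Literature.MathematicalPhysics.QuantumFieldTheory.Balaban1983to89.Node00
open Literature.MathematicalPhysics.QuantumFieldTheory.Balaban1983to89.Node00.Sect2 (domSys domCount CPair)
open Literature.MathematicalPhysics.QuantumFieldTheory.Balaban1983to89.Node00.W1

/-! ## §2 R1aᴬ: R1a's uncentred heredity with ONE guard supplied along the generated histories -/

section Guarded

variable (F : T4Family) (K : ℕ) {𝔸 : Type*} {M : ℕ} [NeZero M] (L : ℕ) [NeZero L]

/-- Updating slot `i` of a history slot-wise in `D` by a point of `D i` keeps it slot-wise in `D` (node00-def-W1 W1-13's `mem_update_of_forall_mem_fam`; restated privately to keep this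
file's imports as announced). [folklore] -/
private theorem update_mem_family {D : ℕ → Set ℂ} {h : ℕ → ℂ} (hh : ∀ n, h n ∈ D n) {i : ℕ} {z : ℂ} (hz : z ∈ D i) (n : ℕ) :
    Function.update h i z n ∈ D n := by
  rcases eq_or_ne n i with rfl | hne
  · simpa using hz
  · rw [Function.update_of_ne hne]; exact hh n

open Classical in
/-- **★ R1aᴬ = module R1a's `holoBound_recTerm_ofTerms` WITH A GUARD.**  R1a §2 VERBATIM except: a predicate family `Q k′` on older-term families (the record's instance: «analytic
on the tables», [I] p. 263 — the field-analyticity the size-only binder lacked, lens T32) GUARDS both per-term schemas — (S-last-T′) is asked only for older-term families that are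
(1.18)`(A,κ)`-bounded AND satisfy `Q k′`, (S-226-T′) only along curves whose values satisfy `Q k′` pointwise on `D i` — and ONE hypothesis `hQ`: the generated older terms satisfy `Q`
along every history `h` with `h n ∈ D n` (slot-wise; node00-def-W1 W1-13's `W1.RecAdmissibleFamBelow (GenTower.ofTerms L TF) D Q Kr` unfolded).  SAME conclusion, SAME induction,
SAME invariant: the two application sites are the real window history `↑g` and its one-slot updates `↑g|i:=z`, `z ∈ D i`, both slot-wise in `D` (`hDw`).  At `Q := ⊤` this is R1a.
`hQ`'s inhabitant: module A0 §1b for the family at hand (the continued family of the leaf; inside R1bᴬ, the interpolation family).  (lens Sketch22 §2, ported with attribution.)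
[cite: Balaban1987RG1, §0 p.256, §1 p.263, p.266 and (2.13) p.268; Balaban1988RG2Cluster, (1.41) p.11, (2.14) p.15, (2.26) p.17 and (2.39)-(2.41) p.21] -/
theorem holoBound_recTerm_ofTerms_guarded (TF : GenTermFun (F.P K) 𝔸 M L) (sp : (j : ℕ) → (domSys (F.P K) M j).Dom → Set (CPair (F.P K) 𝔸))
    (Q : (k' : ℕ) → OlderTerms (F.P K) 𝔸 M k' → Prop)
    (c : B13.Consts) (hL : 8 ≤ c.L) (hLc : c.L = L) {a a₂ a₂' a₅ Aabs : ℝ} (hN : Lemma3Numerics c M ((c.L : ℝ) / 2) a a₂ a₂' a₅ Aabs)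
    {γ A κ r₁ : ℝ} (hA0 : 0 ≤ c.C3act * c.ε₁) (hr₁ : 0 ≤ r₁) (hκ : κ ≤ r₁)
    (hrate : r₁ + 2 * (64 * Real.log 162) + 2 ≤ (1 - 8 * c.δ) * ((c.L : ℝ) / 2) * c.κ)
    (hsmall : c.C3act * c.ε₁ * Real.exp (5 * r₁ + 1) * K₀ 64 8 * 9 * 64 ≤ 1)
    (hrenew : Real.exp 1 * 9 * 64 * K₀ 64 8 ^ 2 * (c.C3act * c.ε₁) ≤ A)
    (D : ℕ → Set ℂ) (hDo : ∀ i, IsOpen (D i)) (hDw : ∀ (i : ℕ), ∀ t ∈ Ioc (0 : ℝ) γ, ((t : ℝ) : ℂ) ∈ D i) (Kr : ℕ)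
    (hQ : ∀ h : ℕ → ℂ, (∀ n, h n ∈ D n) → ∀ k' : ℕ, k' < Kr → Q k' (olderOf (recTerm (GenTower.ofTerms L TF) h) k'))
    (hlast : ∀ k' : ℕ, k' < Kr → ∀ old : OlderTerms (F.P K) 𝔸 M k',
      (∀ (j : Fin (k' + 1)) (Y : (domSys (F.P K) M j).Dom) (ψ : CPair (F.P K) 𝔸), ψ ∈ sp j Y → ‖old j Y ψ‖ ≤ A * Real.exp (-(κ * torusTreeLen Y.1))) →
      Q k' old →
      ∀ (X : (domSys (F.P K) M (k' + 1)).Dom) (φ : CPair (F.P K) 𝔸), φ ∈ sp (k' + 1) X → ∀ (Z : (domSys (F.P K) M (k' + 1)).Dom), Z.1 ⊆ X.1 → ∀ t ∈ terms L M Z,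
        DifferentiableOn ℂ (fun z => TF k' Z t z old φ) (D k') ∧ ∀ z ∈ D k', ‖TF k' Z t z old φ‖ ≤ weight L M c Z a t * Real.exp (a₅ * ((Z.1).card : ℝ)))
    (hprop : ∀ k' : ℕ, k' < Kr → ∀ i : ℕ, i < k' → ∀ u ∈ D k', ∀ cv : ℂ → OlderTerms (F.P K) 𝔸 M k',
      (∀ (j : Fin (k' + 1)) (Y : (domSys (F.P K) M j).Dom) (ψ : CPair (F.P K) 𝔸), ψ ∈ sp j Y →
        DifferentiableOn ℂ (fun z => cv z j Y ψ) (D i) ∧ ∀ z ∈ D i, ‖cv z j Y ψ‖ ≤ A * Real.exp (-(κ * torusTreeLen Y.1))) →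
      (∀ z ∈ D i, Q k' (cv z)) →
      ∀ (X : (domSys (F.P K) M (k' + 1)).Dom) (φ : CPair (F.P K) 𝔸), φ ∈ sp (k' + 1) X → ∀ (Z : (domSys (F.P K) M (k' + 1)).Dom), Z.1 ⊆ X.1 → ∀ t ∈ terms L M Z,
        DifferentiableOn ℂ (fun z => TF k' Z t u (cv z) φ) (D i) ∧ ∀ z ∈ D i, ‖TF k' Z t u (cv z) φ‖ ≤ weight L M c Z a t * Real.exp (a₅ * ((Z.1).card : ℝ))) :
    ∀ (j : ℕ), j ≤ Kr → ∀ (g : ℕ → ℝ), g ∈ Window γ → ∀ (X : (domSys (F.P K) M j).Dom) (φ : CPair (F.P K) 𝔸), φ ∈ sp j X →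
      ‖recTerm (GenTower.ofTerms L TF) (fun n => ((g n : ℝ) : ℂ)) j X φ‖ ≤ A * Real.exp (-(κ * torusTreeLen X.1)) ∧
      ∀ i : ℕ, i < j →
        DifferentiableOn ℂ (fun z => recTerm (GenTower.ofTerms L TF) (Function.update (fun n => ((g n : ℝ) : ℂ)) i z) j X φ) (D i) ∧
        ∀ z ∈ D i, ‖recTerm (GenTower.ofTerms L TF) (Function.update (fun n => ((g n : ℝ) : ℂ)) i z) j X φ‖ ≤ A * Real.exp (-(κ * torusTreeLen X.1)) := by
  -- ported from lens Sketch22 §2 (ym-lens-BalabanUVNodes-transfer g22), with attribution: R1a's proof + three tokens (`hgcD`, `hcvQ`, `hQ gc hgcD i hk'`)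
  set G : GenTower (F.P K) 𝔸 M := GenTower.ofTerms L TF with hG
  have hApos : 0 ≤ A := le_trans (by positivity) hrenew
  -- strong induction on the level, packaged as `∀ n, ∀ j ≤ n, …`
  suffices h : ∀ (n j : ℕ), j ≤ n → j ≤ Kr → ∀ (g : ℕ → ℝ), g ∈ Window γ → ∀ (X : (domSys (F.P K) M j).Dom) (φ : CPair (F.P K) 𝔸), φ ∈ sp j X →
      ‖recTerm G (fun n => ((g n : ℝ) : ℂ)) j X φ‖ ≤ A * Real.exp (-(κ * torusTreeLen X.1)) ∧
      ∀ i : ℕ, i < j →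
        DifferentiableOn ℂ (fun z => recTerm G (Function.update (fun n => ((g n : ℝ) : ℂ)) i z) j X φ) (D i) ∧
        ∀ z ∈ D i, ‖recTerm G (Function.update (fun n => ((g n : ℝ) : ℂ)) i z) j X φ‖ ≤ A * Real.exp (-(κ * torusTreeLen X.1)) from
    fun j hj => h j j le_rfl hj
  intro n
  induction n with
  | zero =>
    intro j hj _ g _ X φ _
    obtain rfl : j = 0 := Nat.le_zero.mp hj
    refine ⟨?_, fun i hi => absurd hi (Nat.not_lt_zero i)⟩
    rw [recTerm_zero, norm_zero]
    positivity
  | succ n ih =>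
    intro j hj hjK g hg X φ hφ
    rcases Nat.lt_succ_iff_lt_or_eq.mp (Nat.lt_succ_of_le hj) with hjn | rfl
    · exact ih j (Nat.lt_succ_iff.mp hjn) hjK g hg X φ hφ
    · -- level `n + 1 = k' + 1` with `k' = n < Kr`
      have hk' : n < Kr := Nat.lt_of_succ_le hjK
      set gc : ℕ → ℂ := fun m => ((g m : ℝ) : ℂ) with hgc
      -- (ᴬ) the real window history is slot-wise in `D`, so `hQ` guards it and its one-slot updates
      have hgcD : ∀ m, gc m ∈ D m := fun m => hDw m (g m) (hg m)
      -- (1.18) of the generated older terms at the real history (induction hypothesis (a) at the levels `≤ n`)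
      have holdB : ∀ (j' : Fin (n + 1)) (Y : (domSys (F.P K) M j').Dom) (ψ : CPair (F.P K) 𝔸), ψ ∈ sp j' Y →
          ‖olderOf (recTerm G gc) n j' Y ψ‖ ≤ A * Real.exp (-(κ * torusTreeLen Y.1)) := fun j' Y ψ hψ =>
        (ih j'.1 (Nat.lt_succ_iff.mp j'.2) ((Nat.le_of_lt_succ j'.2).trans hk'.le) g hg Y ψ hψ).1
      -- (b): every young coupling `i < n + 1`
      have hb : ∀ i : ℕ, i < n + 1 →
          DifferentiableOn ℂ (fun z => recTerm G (Function.update gc i z) (n + 1) X φ) (D i) ∧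
          ∀ z ∈ D i, ‖recTerm G (Function.update gc i z) (n + 1) X φ‖ ≤ A * Real.exp (-(κ * torusTreeLen X.1)) := by
        intro i hi
        rcases Nat.lt_succ_iff_lt_or_eq.mp hi with hin | rfl
        · -- an OLDER coupling `i < n`: through the older terms only
          set cv : ℂ → OlderTerms (F.P K) 𝔸 M n := fun z => olderOf (recTerm G (Function.update gc i z)) n with hcv
          have hsec : ∀ z, recTerm G (Function.update gc i z) (n + 1) X φ = (StepGen.ofTerms L (TF n)).E (gc n) (cv z) φ X := by
            intro z
            rw [recTerm_succ, Function.update_of_ne (ne_of_gt hin)]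
            rfl
          have hcvB : ∀ (j' : Fin (n + 1)) (Y : (domSys (F.P K) M j').Dom) (ψ : CPair (F.P K) 𝔸), ψ ∈ sp j' Y →
              DifferentiableOn ℂ (fun z => cv z j' Y ψ) (D i) ∧ ∀ z ∈ D i, ‖cv z j' Y ψ‖ ≤ A * Real.exp (-(κ * torusTreeLen Y.1)) := by
            intro j' Y ψ hψ
            have hj'K : j'.1 ≤ Kr := (Nat.le_of_lt_succ j'.2).trans hk'.le
            by_cases hij : i < j'.1
            · exact (ih j'.1 (Nat.lt_succ_iff.mp j'.2) hj'K g hg Y ψ hψ).2 i hij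
            · have hconst : ∀ z, cv z j' Y ψ = recTerm G gc j'.1 Y ψ := fun z =>
                recTerm_congr_prefix G j'.1 (fun m hm => Function.update_of_ne (Nat.ne_of_lt (lt_of_lt_of_le hm (Nat.not_lt.1 hij))) z gc) Y ψ
              refine ⟨(differentiableOn_const (recTerm G gc j'.1 Y ψ)).congr fun z _ => hconst z, fun z _ => ?_⟩
              rw [hconst z]
              exact (ih j'.1 (Nat.lt_succ_iff.mp j'.2) hj'K g hg Y ψ hψ).1
          -- (ᴬ) the guard of the generated older-term curve, pointwise on `D i`, from `hQ` at the one-slot updates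
          have hcvQ : ∀ z ∈ D i, Q n (cv z) := fun z hz => hQ (Function.update gc i z) (update_mem_family hgcD hz) n hk'
          have key := holoBound_E_ofTerms_of_termwise F K L (TF n) c hL hLc hN hA0 hr₁ hκ hrate hsmall hrenew (fun _ => gc n) cv φ X (D i) (hDo i)
            (hprop n hk' i hin (gc n) (hDw n (g n) (hg n)) cv hcvB hcvQ X φ hφ)
          exact ⟨key.1.congr fun z _ => hsec z, fun z hz => by rw [hsec z]; exact key.2 z hz⟩
        · -- the LAST coupling `g_n` of step `n`: the older terms do not read it
          have hsec : ∀ z, recTerm G (Function.update gc i z) (i + 1) X φ = (StepGen.ofTerms L (TF i)).E z (olderOf (recTerm G gc) i) φ X := by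
            intro z
            rw [recTerm_succ, Function.update_self]
            refine congrArg (fun old => (StepGen.ofTerms L (TF i)).E z old φ X) ?_
            funext j' Y ψ
            exact recTerm_congr_prefix G j'.1 (fun m hm => Function.update_of_ne (Nat.ne_of_lt (lt_of_lt_of_le hm (Nat.le_of_lt_succ j'.2))) z gc) Y ψ
          -- (ᴬ) the guard of the generated older terms at the real history, from `hQ`
          have key := holoBound_E_ofTerms_of_termwise F K L (TF i) c hL hLc hN hA0 hr₁ hκ hrate hsmall hrenew (fun z => z)
            (fun _ => olderOf (recTerm G gc) i) φ X (D i) (hDo i) (hlast i hk' _ holdB (hQ gc hgcD i hk') X φ hφ)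
          exact ⟨key.1.congr fun z _ => hsec z, fun z hz => by rw [hsec z]; exact key.2 z hz⟩
      refine ⟨?_, hb⟩
      -- (a): (b) at the window point `z = g_n`
      have h := (hb n (Nat.lt_succ_self n)).2 (gc n) (hDw n (g n) (hg n))
      rwa [Function.update_eq_self] at h

end Guarded

/-! ## §3 The record's instance: guard = «analytic on the tables», supplied by module A0 §1b from ONE new termwise schema (T-an)[TF] -/

section GuardedAdm

variable (F : T4Family) (K : ℕ) {𝔸 : Type} [NormedRing 𝔸] [NormedAlgebra ℂ 𝔸] {M : ℕ} [NeZero M] (L : ℕ) [NeZero L]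

open Classical in
/-- **★ R1a's CONCLUSION FROM THE GUARDED SCHEMAS + ONE TERMWISE φ-ANALYTICITY SCHEMA** (what module R2ᴬ instantiates at `TF := TFc`, `A := E₀`, `κ := li.κ`): hypotheses = module
R1a's with both per-term schemas GUARDED by [I] p. 263's admissible class «(1.18)`(A,κ)` on the tables ∧ analytic there» (exactly what the datum's Lemma-2∕3 letters deliver, lens
T32∕E8; node00-def-W1 `W1.AdmHist sp A κ k′` unfolded), PLUS the tables' restriction property `hrestr` ([II] p. 15; dag-n18-c `…N18HLayerW1SpaceRestr` at the tables of record), PLUS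
(T-an)[TF]: slot-wise on `D`, at (1.18)`(A,r₁)`-bounded analytic older terms every term is analytic in `φ` at the points of `sp (k′+1) Z` ([II] (2.14) p. 15 with Lemma 2 — dag-n18-c's
(T-an) VERBATIM, read per slot), and N18's STRICT [KP86] clause.  Proof: §2 at `Q := «analytic on the tables»`, `hQ` := module A0 §1b, whose (T-226) input is the guarded (S-last-T′).2
at `X := Z` (class conversion `κ ≤ r₁`; `d_j = torusTreeLen` by `rfl`).  (lens Sketch22 §2c, ported with attribution.)
[cite: Balaban1987RG1, §1 p.263 ((1.18) and the clause before it), Thm 1 p.259 and (2.13) p.268; Balaban1988RG2Cluster, (1.41) p.11, (2.14) p.15, (2.26) p.17, (2.39)-(2.41) p.21 and p.22] -/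
theorem holoBound_recTerm_ofTerms_adm (TF : GenTermFun (F.P K) 𝔸 M L) (sp : (j : ℕ) → (domSys (F.P K) M j).Dom → Set (CPair (F.P K) 𝔸))
    (hrestr : ∀ k, SpRestr (sp (k + 1)))
    (c : B13.Consts) (hL : 8 ≤ c.L) (hLc : c.L = L) {a a₂ a₂' a₅ Aabs : ℝ} (hN : Lemma3Numerics c M ((c.L : ℝ) / 2) a a₂ a₂' a₅ Aabs)
    {γ A κ r₁ : ℝ} (hA0 : 0 ≤ c.C3act * c.ε₁) (hr₁ : 0 ≤ r₁) (hκ : κ ≤ r₁)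
    (hrate : r₁ + 2 * (64 * Real.log 162) + 2 ≤ (1 - 8 * c.δ) * ((c.L : ℝ) / 2) * c.κ)
    (hsmall : c.C3act * c.ε₁ * Real.exp (5 * r₁ + 1) * K₀ 64 8 * 9 * 64 < 1)
    (hrenew : Real.exp 1 * 9 * 64 * K₀ 64 8 ^ 2 * (c.C3act * c.ε₁) ≤ A)
    (D : ℕ → Set ℂ) (hDo : ∀ i, IsOpen (D i)) (hDw : ∀ (i : ℕ), ∀ t ∈ Ioc (0 : ℝ) γ, ((t : ℝ) : ℂ) ∈ D i) (Kr : ℕ)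
    (hTanD : ∀ k' : ℕ, k' < Kr → ∀ t ∈ D k', ∀ old : OlderTerms (F.P K) 𝔸 M k',
      (∀ (j : Fin (k' + 1)) (Y : (domSys (F.P K) M j).Dom), ∀ ψ ∈ sp j Y,
          ‖old j Y ψ‖ ≤ A * Real.exp (-(r₁ * (domSys (F.P K) M j).dj Y))) →
      (∀ (j : Fin (k' + 1)) (Y : (domSys (F.P K) M j).Dom), AnalyticOnNhd ℂ (old j Y) (sp j Y)) →
      ∀ (Z : (domSys (F.P K) M (k' + 1)).Dom), ∀ τ ∈ terms L M Z, AnalyticOnNhd ℂ (fun φ => TF k' Z τ t old φ) (sp (k' + 1) Z))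
    (hlast : ∀ k' : ℕ, k' < Kr → ∀ old : OlderTerms (F.P K) 𝔸 M k',
      (∀ (j : Fin (k' + 1)) (Y : (domSys (F.P K) M j).Dom) (ψ : CPair (F.P K) 𝔸), ψ ∈ sp j Y → ‖old j Y ψ‖ ≤ A * Real.exp (-(κ * torusTreeLen Y.1))) →
      (∀ (j : Fin (k' + 1)) (Y : (domSys (F.P K) M j).Dom), AnalyticOnNhd ℂ (old j Y) (sp j Y)) →
      ∀ (X : (domSys (F.P K) M (k' + 1)).Dom) (φ : CPair (F.P K) 𝔸), φ ∈ sp (k' + 1) X → ∀ (Z : (domSys (F.P K) M (k' + 1)).Dom), Z.1 ⊆ X.1 → ∀ t ∈ terms L M Z,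
        DifferentiableOn ℂ (fun z => TF k' Z t z old φ) (D k') ∧ ∀ z ∈ D k', ‖TF k' Z t z old φ‖ ≤ weight L M c Z a t * Real.exp (a₅ * ((Z.1).card : ℝ)))
    (hprop : ∀ k' : ℕ, k' < Kr → ∀ i : ℕ, i < k' → ∀ u ∈ D k', ∀ cv : ℂ → OlderTerms (F.P K) 𝔸 M k',
      (∀ (j : Fin (k' + 1)) (Y : (domSys (F.P K) M j).Dom) (ψ : CPair (F.P K) 𝔸), ψ ∈ sp j Y →
        DifferentiableOn ℂ (fun z => cv z j Y ψ) (D i) ∧ ∀ z ∈ D i, ‖cv z j Y ψ‖ ≤ A * Real.exp (-(κ * torusTreeLen Y.1))) →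
      (∀ z ∈ D i, ∀ (j : Fin (k' + 1)) (Y : (domSys (F.P K) M j).Dom), AnalyticOnNhd ℂ (cv z j Y) (sp j Y)) →
      ∀ (X : (domSys (F.P K) M (k' + 1)).Dom) (φ : CPair (F.P K) 𝔸), φ ∈ sp (k' + 1) X → ∀ (Z : (domSys (F.P K) M (k' + 1)).Dom), Z.1 ⊆ X.1 → ∀ t ∈ terms L M Z,
        DifferentiableOn ℂ (fun z => TF k' Z t u (cv z) φ) (D i) ∧ ∀ z ∈ D i, ‖TF k' Z t u (cv z) φ‖ ≤ weight L M c Z a t * Real.exp (a₅ * ((Z.1).card : ℝ))) :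
    ∀ (j : ℕ), j ≤ Kr → ∀ (g : ℕ → ℝ), g ∈ Window γ → ∀ (X : (domSys (F.P K) M j).Dom) (φ : CPair (F.P K) 𝔸), φ ∈ sp j X →
      ‖recTerm (GenTower.ofTerms L TF) (fun n => ((g n : ℝ) : ℂ)) j X φ‖ ≤ A * Real.exp (-(κ * torusTreeLen X.1)) ∧
      ∀ i : ℕ, i < j →
        DifferentiableOn ℂ (fun z => recTerm (GenTower.ofTerms L TF) (Function.update (fun n => ((g n : ℝ) : ℂ)) i z) j X φ) (D i) ∧
        ∀ z ∈ D i, ‖recTerm (GenTower.ofTerms L TF) (Function.update (fun n => ((g n : ℝ) : ℂ)) i z) j X φ‖ ≤ A * Real.exp (-(κ * torusTreeLen X.1)) := by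
  -- ported from lens Sketch22 §2c (ym-lens-BalabanUVNodes-transfer g22), with attribution
  have hApos : 0 ≤ A := le_trans (by positivity) hrenew
  -- class conversion: (1.18)`(A,r₁)` read with `d_j` ⟹ (1.18)`(A,κ)` read with `torusTreeLen` (`κ ≤ r₁`, `d_j = torusTreeLen` by `rfl`)
  have hconv : ∀ (k' : ℕ) (old : OlderTerms (F.P K) 𝔸 M k'),
      (∀ (j : Fin (k' + 1)) (Y : (domSys (F.P K) M j).Dom), ∀ ψ ∈ sp j Y, ‖old j Y ψ‖ ≤ A * Real.exp (-(r₁ * (domSys (F.P K) M j).dj Y))) →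
      ∀ (j : Fin (k' + 1)) (Y : (domSys (F.P K) M j).Dom) (ψ : CPair (F.P K) 𝔸), ψ ∈ sp j Y → ‖old j Y ψ‖ ≤ A * Real.exp (-(κ * torusTreeLen Y.1)) := by
    intro k' old hB j Y ψ hψ
    refine (hB j Y ψ hψ).trans (mul_le_mul_of_nonneg_left (Real.exp_le_exp.mpr ?_) hApos)
    show -(r₁ * torusTreeLen Y.1) ≤ -(κ * torusTreeLen Y.1)
    exact neg_le_neg (mul_le_mul_of_nonneg_right hκ (torusTreeLen_nonneg Y.1))
  refine holoBound_recTerm_ofTerms_guarded F K L TF sp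
    (fun k' old => ∀ (j : Fin (k' + 1)) (Y : (domSys (F.P K) M j).Dom), AnalyticOnNhd ℂ (old j Y) (sp j Y))
    c hL hLc hN hA0 hr₁ hκ hrate hsmall.le hrenew D hDo hDw Kr ?_ hlast hprop
  -- `hQ`: module A0 §1b at the class (1.18)`(A,r₁)`; its (T-226) input is the guarded (S-last-T′).2 at `X := Z`
  intro h hh k' hk'
  refine (admissibleBelow_along_of_termwise_family F K L TF D sp hrestr c hL hLc hN Kr hTanD ?_ hr₁ hA0 hrate hsmall hrenew h hh k' hk'.le).2
  intro k hk t ht old hB hAn Z φ hφ τ hτ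
  exact ((hlast k hk old (hconv k old hB) hAn Z φ hφ Z (Finset.Subset.refl _) τ hτ).2) t ht

end GuardedAdm

end YMDAG.N22.W1

end
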